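import Summits.CriticalPhenomena.CardyFormulaZ2.Theorems.CardySusyWardParafermionPrecompactFourClassTransferOfEdgePrecompact

/-!
# Lead c5 certificate — crux stmt-CriticalPhenomena-11293 `CardySusyWard.ParafermionPrecompact`

Re-certified against the LIVE tree by seat `prover-line-stmt-CriticalPhenomena-11293-c5-0`
(2026-08-16, route file `Theses/CardySusyWard.lean` mtime 2026-08-16T19:48Z, decl text = rev 5,
no `edgeSet` guards).  Everything here is glue over LANDED theorems (p74235, p115329).

* `typed_iff_not_H`       : typed decl `↔ ¬ ParafermionBulkNondegenerate` (`H`, `[status: open]`).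
* `typed_iff_repaired_and_not_H` : typed decl `↔ (∀ D Λ, RepairedAt D Λ) ∧ ¬H`.
* `transfer_iff_not_H_of_repaired` : for EVERY proof line (conclusion `C′ = ∀ D Λ, RepairedAt D Λ`),
  the transfer step `C′ → typed` is equivalent to `C′ → ¬H`.
* `not_typed_iff_H`       : a refutation line must prove `H` itself.
* `repaired_of_edgePrecompact` : `C′ ⇐ CardyComplexCone.EdgePrecompact` (stmt-CriticalPhenomena-11387).
-/

namespace Summit.CriticalPhenomena.CardyFormulaZ2.Cruxes.ParafermionPrecompact.LeadC5

open _root_.Literature.Probability.LatticeModels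
open _root_.Literature.Probability.RandomPlanarGeometry (DobrushinDomain)
open Summit.CriticalPhenomena.CardyFormulaZ2.Theorems.ParafermionPrecompact.Negative
open Summit.CriticalPhenomena.CardyFormulaZ2.Theses.CardyComplexCone (EdgePrecompact)

/-- Read-back: the typed decl is still the rev-5 text (no `edgeSet` guards). [folklore] -/
theorem typed_readback :
    Theses.CardySusyWard.ParafermionPrecompact ↔
    ∀ (D : Literature.Probability.RandomPlanarGeometry.DobrushinDomain) (Λ : ℝ → Literature.Probability.LatticeModels.DiscreteDobrushin), (∀ δ, (Λ δ).Ω = D.carrier) → (∀ δ, (Λ δ).δ = δ) → Filter.Tendsto (fun δ : ℝ => Metric.hausdorffEDist (Λ δ).arcA (D.arc 0)) (nhdsWithin (0:ℝ) (Set.Ioi 0)) (nhds 0) → Filter.Tendsto (fun δ : ℝ => Metric.hausdorffEDist (Λ δ).arcB (D.arc 1)) (nhdsWithin (0:ℝ) (Set.Ioi 0)) (nhds 0) → Filter.Tendsto (fun δ : ℝ => Metric.hausdorffEDist (Literature.Probability.LatticeModels.medialPoint δ '' (Λ δ).zdABEdges) {D.pt 0, D.pt 1}) (nhdsWithin (0:ℝ)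 (Set.Ioi 0)) (nhds 0) → (∀ᶠ δ in nhdsWithin (0:ℝ) (Set.Ioi 0), (Λ δ).IsZdAdmissible) → ∀ K : Set ℂ, IsCompact K → K ⊆ D.carrier → (∃ C : ℝ, ∀ᶠ δ in nhdsWithin (0:ℝ) (Set.Ioi 0), ∀ z : Literature.Probability.LatticeModels.MedialVertex, Literature.Probability.LatticeModels.medialPoint δ z ∈ K → ‖(∫ ω, Literature.Probability.LatticeModels.passageSum (Literature.Probability.LatticeModels.medialExploration (Λ δ) ω) δ (1 / 3) z ∂(Literature.Probability.Percolation.bondPercolation (Literature.Probability.LatticeModels.zdGraph 2) Literature.Probability.Percolation.half))‖ ≤ C * δ ^ ((1:ℝ) / 3)) ∧ (∀ ε > (0:ℝ), ∃ η > (0:ℝ), ∀ᶠ δ in nhdsWithin (0:ℝ) (Set.Ioi 0), ∀ z z' : Literature.Probability.LatticeModels.MedialVertex, Literature.Probability.LatticeModels.medialPoint δ z ∈ K → Literature.Probability.LatticeModels.medialPoint δ z' ∈ K → dist (Literature.Probability.LatticeModels.medialPoint δ z) (Literature.Probability.LatticeModels.medialPoint δ z') < η → ‖(∫ ω, Literature.Probability.LatticeModels.passageSum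 (Literature.Probability.LatticeModels.medialExploration (Λ δ) ω) δ (1 / 3) z ∂(Literature.Probability.Percolation.bondPercolation (Literature.Probability.LatticeModels.zdGraph 2) Literature.Probability.Percolation.half)) - (∫ ω, Literature.Probability.LatticeModels.passageSum (Literature.Probability.LatticeModels.medialExploration (Λ δ) ω) δ (1 / 3) z' ∂(Literature.Probability.Percolation.bondPercolation (Literature.Probability.LatticeModels.zdGraph 2) Literature.Probability.Percolation.half))‖ ≤ ε * δ ^ ((1:ℝ) / 3)) :=
  Iff.rfl

/-- The typed crux is the negation of the open conjecture `H`. [folklore] -/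
theorem typed_iff_not_H :
    Theses.CardySusyWard.ParafermionPrecompact ↔ ¬ ParafermionBulkNondegenerate :=
  parafermionPrecompact_iff_not_bulkNondegenerate

/-- The typed crux = the repaired crux AND `¬H`. [folklore] -/
theorem typed_iff_repaired_and_not_H :
    Theses.CardySusyWard.ParafermionPrecompact ↔
      (∀ (D : DobrushinDomain) (Λ : ℝ → DiscreteDobrushin), ParafermionPrecompactRepairedAt D Λ) ∧
        ¬ ParafermionBulkNondegenerate :=
  ⟨fun h => ⟨repaired_of_parafermionPrecompact h, typed_iff_not_H.1 h⟩, fun h => typed_iff_not_H.2 h.2⟩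

/-- **Transfer test for every proof line.**  A line whose composition concludes the repaired crux
`C′` reaches the typed decl iff it also proves `C′ → ¬H`. [folklore] -/
theorem transfer_iff_not_H_of_repaired :
    ((∀ (D : DobrushinDomain) (Λ : ℝ → DiscreteDobrushin), ParafermionPrecompactRepairedAt D Λ) →
        Theses.CardySusyWard.ParafermionPrecompact) ↔
    ((∀ (D : DobrushinDomain) (Λ : ℝ → DiscreteDobrushin), ParafermionPrecompactRepairedAt D Λ) →
        ¬ ParafermionBulkNondegenerate) := by
  rw [typed_iff_not_H]

/-- **Transfer test for a refutation line.**  Refuting the typed decl is proving `H`. [folklore] -/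
theorem not_typed_iff_H :
    ¬ Theses.CardySusyWard.ParafermionPrecompact ↔ ParafermionBulkNondegenerate := by
  rw [typed_iff_not_H, not_not]

/-- The repaired crux from `EdgePrecompact` (stmt-CriticalPhenomena-11387), landed glue. [folklore] -/
theorem repaired_of_edgePrecompact (hEP : EdgePrecompact) :
    ∀ (D : DobrushinDomain) (Λ : ℝ → DiscreteDobrushin), ParafermionPrecompactRepairedAt D Λ :=
  FourClassVertexTransfer.repairedAt_of_edgePrecompact hEP

end Summit.CriticalPhenomena.CardyFormulaZ2.Cruxes.ParafermionPrecompact.LeadC5
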